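import Mathlib
import Literature.Combinatorics.Optimization.MaxCutCspHardness
import Literature.Combinatorics.Optimization.PolySizeLpIntegralityGaps
import HarnessLib

/-!
# LP inapproximability of binary CSPs by reduction from MaxCUT (Braun–Pokutta–Zink 2015, §6.2–6.3)

G. Braun, S. Pokutta, D. Zink, *Inapproximability of combinatorial problems via small LPs and SDPs*, STOC 2015
[BraunPokuttaZink2015] (held `paper:arxiv-1410.8816`, §6.2–6.3, p. 20–21).  Printed (all "for infinitely many `n`",
`n` = number of variables, via the affine reductions of Def. 4.1 / Prop. 4.2 / Cor. 4.4 from the MaxCUT base theorem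
`fc(MaxCUT, 1−ε, 1/2+ε) ≥ n^{Ω(log n/loglog n)}` of [CLRS13], which rests on [CMM09]):
* **Cor. 6.4** (Def. 6.3: Max-2-CSP = all constraints on ≤ 2 variables; Max-2-CONJSAT = all conjunctions of two
  literals): `fc(Max-2-CSP, 1−ε, 1/2+ε) ≥ n^{Ω(log n/loglog n)}` ("We identify Max-2-XOR as a subproblem of
  Max-2-CSP") and `fc(Max-2-CONJSAT, 1/2−ε, 1/4+ε) ≥ n^{Ω(log n/loglog n)}`.
* **Cor. 6.6** (Def. 6.5: Max-`k`-SAT): `fc(MaxSAT2, 1−ε, 3/4+ε) ≥ n^{Ω(log n/loglog n)}` — "We reduce MaxCUT to MaxSAT2. For a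
  2-XOR clause `l = (x_i ⊕ x_j = 1)` … two auxiliary constraints `C_1(l) = (x_i ∨ x_j)` and `C_2(l) = (x̄_i ∨ x̄_j)` …
  `γ` the identity map. … whenever `l` is satisfied … both … are also satisfied, otherwise exactly one".
* **Cor. 6.8** (Def. 6.7: MaxDICUT, `𝒞_DICUT = {¬x_i ∧ x_j}`): `fc(MaxDICUT, 1/2−ε, 1/4+ε) ≥ n^{Ω(log n/loglog n)}` —
  "replace every clause `l = (x_i ⊕ x_j = 1)` with `C_1(l) = ¬x_i ∧ x_j` and `C_2(l) = x_i ∧ ¬x_j` … exactly one … is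
  also satisfied … otherwise neither".

This file PROVES these reductions in the tree's native Max-CSP model (`CSPInstance k n 𝒫`, objective = fraction of
satisfied constraints; LP relaxations `LPRelaxation k n 𝒫 R` of Kothari–Meka–Raghavendra Def. 1.1 with
`Achieves c s`; subspace sum-of-squares certificates `AchievesApprox 𝒫 U c s` of Lee–Raghavendra–Steurer Def. 1.4)
and feeds them with the tree's two MaxCUT inputs.  No named facts.

* `CSPInstance.expand` / `expand_val` / `expand_optLE` — "`β(L) := {C_1(l), …, C_m(l) | l ∈ L}`, `γ = id`": every
  constraint replaced by `m` constraints on the same variables; if each contributes `u·[C(x)] + t` satisfied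
  constraints then `β(ℑ)(x) = (u ℑ(x) + t)/m`.
* The three printed reductions, each for ANY binary predicate family `𝒫₂` containing the needed predicates:
  `inclInst` (`≠ ∈ 𝒫₂`: Max-2-CSP = `Set.univ`, Cor. 6.4), `satInst` (the clauses `y_0 ∨ y_1`, `ȳ_0 ∨ ȳ_1`, patterns
  `clausePred`; Max-2-SAT = `maxKSatPreds 2`, Cor. 6.6; `ℑ = 2ℑ_SAT − 1`), `dicutInst` (`dicutPred = ¬y_0 ∧ y_1`;
  MaxDICUT = `dicutPreds`, Cor. 6.8, and Max-2-CONJSAT = `literalClosure andTwo` ∋ `dicutPred`, Cor. 6.4;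
  `ℑ = 2ℑ_DICUT`), with the value identities and soundness transfers quoted above.
* LP clause (Prop. 4.2 via the tree's `LPRelaxation.pullback`, `+2` inequalities): `LPRelaxation.maxCut_of_incl`,
  `.maxCut_of_sat`, `.maxCut_of_dicut`.  Subspace/SDP clause: `AchievesApprox.of_affine` (certificates scale:
  `c₁ − ℑ = a(c₂ − ℑ*) = Σ(√a gᵢ)²`), `AchievesApprox.maxCut_of_incl/_sat/_dicut`.
* **UNCONDITIONAL consequences** (input: `maxCut_poly_lp` and `maxCut_subspace_quasipoly` of `MaxCutCspHardness.lean`,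
  i.e. Max-3-XOR × the TSSW gadgets, MaxCUT hard at `((17−2ε)/21, (16+2ε)/21)` on `N = cutVars n` variables):
  `binaryCsp_poly_lp_of_neq` (`((17−2ε)/21, (16+2ε)/21)`), `maxTwoSat_poly_lp` (`((19−ε)/21, (37+2ε)/42)`, ratio
  `→ 37/38`), `maxDicut_poly_lp` / `maxTwoConjSat_poly_lp` (`((17−2ε)/42, (8+ε)/21)`, ratio `→ 16/17`) — no LP
  relaxation of size `≤ N^C`, every `C`, all large `n`; and the subspace versions `binaryCsp_subspace_quasipoly_of_neq`,
  `maxTwoSat_subspace_quasipoly` (`((18+c)/21, (18+s)/21)`), `maxDicut_subspace_quasipoly`,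
  `maxTwoConjSat_subspace_quasipoly` (`((15+2c)/42, (15+2s)/42)`) for subspaces of dimension
  `≤ N^{γ log N/loglog N}`, `1/2 < s < c < 1`.
* **The PRINTED constants, conditional on [CMM09]** (input: `maxCut_poly_lp_of_CMM` of `PolySizeLpIntegralityGaps.lean`,
  hypothesis `(hCMM : CharikarMakarychevMakarychev2009_maxCutSA)`, the tree's only unproved input here):
  `binaryCsp_poly_lp_of_neq_of_CMM` (`(1−ε, 1/2+ε)`, Cor. 6.4), `maxTwoSat_poly_lp_of_CMM` (`(1−ε, 3/4+ε)`, Cor. 6.6),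
  `maxDicut_poly_lp_of_CMM` / `maxTwoConjSat_poly_lp_of_CMM` (`(1/2−ε, 1/4+ε)`, Cor. 6.8 / Cor. 6.4) — no LP
  relaxation of size `≤ n^{d/2}`, every `d ≥ 2`, all large `n`.

Recorded deviations (bookkeeping, not repairs): (i) the size regime is the one of the tree's MaxCUT inputs
(polynomial `n^{d/2}` for every `d`, resp. `N^{γ log N/loglog N}` along `N = cutVars n = 1 + 2n + 36n³`), where the
paper prints `n^{Ω(log n/loglog n)}` for infinitely many `n`; (ii) the currency is KMR LP relaxations / LRS subspaces
rather than BPZ LP/SDP formulations of `cspProblem` (the tree's `LpFormulationReductions.lean` /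
`CspSdpFormulationComplexity.lean` convert); (iii) the Max-3-SAT clause of Cor. 6.6 ("MaxSAT2 is a subproblem of
MaxSAT3", clauses with AT MOST 3 literals) is not restated: the tree's `maxKSatPreds 3` has exactly-3-literal clauses,
for which the stronger unconditional `7/8 + ε` bound `maxKSat_poly_lp` is already a tree theorem; (iv) the SDP
clauses of Cor. 6.4/6.6/6.8 are printed conditionally on the paper's Conjecture (SDP hardness of MaxCUT at `c_GW`),
an open problem — not Literature; the unconditional subspace versions above are what the tree's MaxCUT SDP input gives.
-/

noncomputable section

open Finset

namespace Literature.Combinatorics.Optimization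

variable {n : ℕ}

/-! ### Expanding every constraint into `m` constraints on the same variables -/

namespace CSPInstance

variable {k k' : ℕ} {P₁ : Set ((Fin k → Bool) → Bool)} {P₂ : Set ((Fin k' → Bool) → Bool)}

/-- **Constraint-wise reductions with `γ = id`**: replace every constraint `C` of an instance by the `m`
constraints `β(C)_0, …, β(C)_{m−1}` on the same variables ("Let `β(L) := {C_1(l), C_2(l) | l ∈ L}` … we
choose `γ` to be the identity map"). [cite: BraunPokuttaZink2015, Def. 4.1 and proof of Cor. 6.6] -/
def expand (I : CSPInstance k n P₁) (m : ℕ) (hm : 0 < m) (β : CSPConstraint k n P₁ → Fin m → CSPConstraint k' n P₂) :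
    CSPInstance k' n P₂ where
  M := I.M * m
  M_pos := Nat.mul_pos I.M_pos hm
  cons i := β (I.cons (finProdFinEquiv.symm i).1) (finProdFinEquiv.symm i).2

/-- **Value of the expanded instance**: if every constraint `C` contributes `u·[C(x)] + t` satisfied
constraints among `β(C)`, then `β(ℑ)(x) = (u·ℑ(x) + t)/m`. [cite: BraunPokuttaZink2015, proof of Cor. 6.6] -/
theorem expand_val (I : CSPInstance k n P₁) {m : ℕ} (hm : 0 < m)
    (β : CSPConstraint k n P₁ → Fin m → CSPConstraint k' n P₂) {u t : ℝ}
    (hβ : ∀ (C : CSPConstraint k n P₁) (x : Fin n → Bool),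
      (∑ b : Fin m, if (β C b).sat x then (1 : ℝ) else 0) = u * (if C.sat x then (1 : ℝ) else 0) + t)
    (x : Fin n → Bool) : (I.expand m hm β).val x = (u * I.val x + t) / m := by
  have hM : (0 : ℝ) < I.M := by exact_mod_cast I.M_pos
  have hmr : (0 : ℝ) < m := by exact_mod_cast hm
  show (∑ i : Fin (I.M * m),
      if (β (I.cons (finProdFinEquiv.symm i).1) (finProdFinEquiv.symm i).2).sat x then (1 : ℝ) else 0) /
        ((I.M * m : ℕ) : ℝ) = (u * ((∑ i, if (I.cons i).sat x then (1 : ℝ) else 0) / (I.M : ℝ)) + t) / m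
  rw [Nat.cast_mul]
  rw [Fintype.sum_equiv finProdFinEquiv.symm
    (fun i : Fin (I.M * m) =>
      if (β (I.cons (finProdFinEquiv.symm i).1) (finProdFinEquiv.symm i).2).sat x then (1 : ℝ) else 0)
    (fun p : Fin I.M × Fin m => if (β (I.cons p.1) p.2).sat x then (1 : ℝ) else 0) (fun i => rfl),
    Fintype.sum_prod_type]
  simp_rw [hβ]
  rw [sum_add_distrib, ← mul_sum, sum_const, card_univ, Fintype.card_fin, nsmul_eq_mul]
  field_simp

/-- Soundness transfer: `opt(ℑ) ≤ s ⇒ opt(β(ℑ)) ≤ (u s + t)/m` (`u ≥ 0`). [cite: BraunPokuttaZink2015, Def. 4.1 (2)] -/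
theorem expand_optLE (I : CSPInstance k n P₁) {m : ℕ} (hm : 0 < m)
    (β : CSPConstraint k n P₁ → Fin m → CSPConstraint k' n P₂) {u t : ℝ} (hu : 0 ≤ u)
    (hβ : ∀ (C : CSPConstraint k n P₁) (x : Fin n → Bool),
      (∑ b : Fin m, if (β C b).sat x then (1 : ℝ) else 0) = u * (if C.sat x then (1 : ℝ) else 0) + t)
    {s : ℝ} (hI : I.OptLE s) : (I.expand m hm β).OptLE ((u * s + t) / m) := by
  intro x
  rw [I.expand_val hm β hβ x]
  have hmr : (0 : ℝ) < m := by exact_mod_cast hm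
  exact div_le_div_of_nonneg_right (by nlinarith [hI x]) hmr.le

end CSPInstance

/-! ### The three reductions from MaxCUT (Cor. 6.4, Cor. 6.6, Cor. 6.8) -/

section Reductions

variable {P₂ : Set ((Fin 2 → Bool) → Bool)}

/-- The MaxCUT predicate `x_i ≠ x_j` (a `2`-XOR clause `x_i ⊕ x_j = 1`). [cite: BraunPokuttaZink2015, Def. 2.4] -/
def neqPred : (Fin 2 → Bool) → Bool := fun y => y 0 != y 1

/-- A MaxCUT constraint evaluates the inequality predicate. [cite: LeeRaghavendraSteurer2015, §1.2 (p. 6)] -/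
theorem maxCut_sat (C : CSPConstraint 2 n maxCutPreds) (x : Fin n → Bool) :
    C.sat x = (x (C.idx 0) != x (C.idx 1)) := by
  have h : C.pred = neqPred := C.pred_mem
  simp [CSPConstraint.sat, h, neqPred]

/-- Two local assignments on two variables agree iff they agree on both coordinates. [folklore] -/
private theorem fin2_fun_eq_iff (y σ : Fin 2 → Bool) : y = σ ↔ y 0 = σ 0 ∧ y 1 = σ 1 := by
  constructor
  · rintro rfl; exact ⟨rfl, rfl⟩
  · intro ⟨h0, h1⟩
    funext j
    fin_cases j
    · exact h0
    · exact h1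

/-- **Cor. 6.4 reduction (MaxCUT is a sub-CSP):** a MaxCUT instance IS an instance of any binary CSP whose
predicate family contains `x_i ≠ x_j` ("We identify MaxCUT = Max-2-XOR as a subproblem of Max-2-CSP").
[cite: BraunPokuttaZink2015, Cor. 6.4 and its proof] -/
def inclInst (hP : neqPred ∈ P₂) (I : CSPInstance 2 n maxCutPreds) : CSPInstance 2 n P₂ :=
  I.expand 1 one_pos fun C _ => ⟨neqPred, hP, C.idx⟩

/-- The included constraint is the original one: `#sat = [x_i ≠ x_j]`. [cite: BraunPokuttaZink2015, proof of Cor. 6.4] -/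
theorem inclInst_count (hP : neqPred ∈ P₂) (C : CSPConstraint 2 n maxCutPreds) (x : Fin n → Bool) :
    (∑ _b : Fin 1, if (CSPConstraint.sat (P := P₂) ⟨neqPred, hP, C.idx⟩ x) then (1 : ℝ) else 0) =
      1 * (if C.sat x then (1 : ℝ) else 0) + 0 := by
  rw [Fin.sum_univ_one, maxCut_sat, one_mul, add_zero]
  rfl

/-- `ℑ(x) = ℑ'(x)` for the inclusion. [cite: BraunPokuttaZink2015, proof of Cor. 6.4] -/
theorem inclInst_val (hP : neqPred ∈ P₂) (I : CSPInstance 2 n maxCutPreds) (x : Fin n → Bool) :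
    I.val x = 1 * (inclInst hP I).val x + 0 := by
  rw [inclInst, I.expand_val one_pos _ (inclInst_count hP) x]
  simp

/-- Soundness: `opt(ℑ) ≤ s ⇒ opt(ℑ') ≤ s`. [cite: BraunPokuttaZink2015, Def. 4.1 (2)] -/
theorem inclInst_optLE (hP : neqPred ∈ P₂) (I : CSPInstance 2 n maxCutPreds) {s : ℝ} (hI : I.OptLE s) :
    (inclInst hP I).OptLE s := by
  have h := I.expand_optLE one_pos _ zero_le_one (inclInst_count hP) hI
  simpa [inclInst] using h

/-- The disjunction falsified exactly by the local pattern `σ` (a `2`-literal clause). [cite: BraunPokuttaZink2015, Def. 6.5] -/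
def clausePred (σ : Fin 2 → Bool) : (Fin 2 → Bool) → Bool := fun y => decide (y ≠ σ)

/-- Clauses are Max-`2`-SAT predicates. [cite: LeeRaghavendraSteurer2015, §1.2 (p. 6)] -/
theorem clausePred_mem (σ : Fin 2 → Bool) : clausePred σ ∈ maxKSatPreds 2 := ⟨σ, rfl⟩

/-- **Cor. 6.6 reduction MaxCUT → Max-2-SAT:** "For a 2-XOR clause `l = (x_i ⊕ x_j = 1)` we define two auxiliary
constraints `C_1(l) = (x_i ∨ x_j)` and `C_2(l) = (x̄_i ∨ x̄_j)`" (falsifying patterns `(0,0)` and `(1,1)`), for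
any predicate family containing both clauses. [cite: BraunPokuttaZink2015, Cor. 6.6 and its proof] -/
def satInst (h0 : clausePred (fun _ => false) ∈ P₂) (h1 : clausePred (fun _ => true) ∈ P₂)
    (I : CSPInstance 2 n maxCutPreds) : CSPInstance 2 n P₂ :=
  I.expand 2 two_pos fun C b =>
    if b = 0 then ⟨clausePred fun _ => false, h0, C.idx⟩ else ⟨clausePred fun _ => true, h1, C.idx⟩

/-- "Whenever `l` is satisfied … both `C_1(l)` and `C_2(l)` are also satisfied, otherwise exactly one of
`C_1(l)` and `C_2(l)` is satisfied": `#sat = 1 + [x_i ≠ x_j]`. [cite: BraunPokuttaZink2015, proof of Cor. 6.6] -/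
theorem satInst_count (h0 : clausePred (fun _ => false) ∈ P₂) (h1 : clausePred (fun _ => true) ∈ P₂)
    (C : CSPConstraint 2 n maxCutPreds) (x : Fin n → Bool) :
    (∑ b : Fin 2, if (CSPConstraint.sat (P := P₂)
        (if b = 0 then ⟨clausePred fun _ => false, h0, C.idx⟩ else ⟨clausePred fun _ => true, h1, C.idx⟩) x)
        then (1 : ℝ) else 0) = 1 * (if C.sat x then (1 : ℝ) else 0) + 1 := by
  rw [Fin.sum_univ_two, maxCut_sat]
  simp only [Fin.isValue, if_true, one_ne_zero, if_false, CSPConstraint.sat, clausePred, ne_eq,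
    fin2_fun_eq_iff, decide_not]
  rcases Bool.eq_false_or_eq_true (x (C.idx 0)) with ha | ha <;>
    rcases Bool.eq_false_or_eq_true (x (C.idx 1)) with hb | hb <;> simp [ha, hb]

/-- `ℑ(x) = 2·ℑ_SAT(x) − 1` (`ℑ_SAT(x) = ½ + ½ ℑ(x)`). [cite: BraunPokuttaZink2015, proof of Cor. 6.6] -/
theorem satInst_val (h0 : clausePred (fun _ => false) ∈ P₂) (h1 : clausePred (fun _ => true) ∈ P₂)
    (I : CSPInstance 2 n maxCutPreds) (x : Fin n → Bool) :
    I.val x = 2 * (satInst h0 h1 I).val x + (-1) := by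
  rw [satInst, I.expand_val two_pos _ (satInst_count h0 h1) x]
  push_cast
  ring

/-- Soundness: `opt(ℑ) ≤ s ⇒ opt(ℑ_SAT) ≤ (1 + s)/2`. [cite: BraunPokuttaZink2015, Def. 4.1 (2) and proof of Cor. 6.6] -/
theorem satInst_optLE (h0 : clausePred (fun _ => false) ∈ P₂) (h1 : clausePred (fun _ => true) ∈ P₂)
    (I : CSPInstance 2 n maxCutPreds) {s : ℝ} (hI : I.OptLE s) : (satInst h0 h1 I).OptLE ((1 + s) / 2) := by
  have h := I.expand_optLE two_pos _ zero_le_one (satInst_count h0 h1) hI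
  have e : ((1 : ℝ) * s + 1) / ((2 : ℕ) : ℝ) = (1 + s) / 2 := by rw [Nat.cast_ofNat]; ring
  rw [e] at h
  exact h

/-- The directed-cut predicate `¬x_i ∧ x_j`. [cite: BraunPokuttaZink2015, Def. 6.7] -/
def dicutPred : (Fin 2 → Bool) → Bool := fun y => !y 0 && y 1

/-- **MaxDICUT** (Def. 6.7): "the CSP with constraint family `𝒞_DICUT = {¬x_i ∧ x_j | i ≠ j}`".
[cite: BraunPokuttaZink2015, Def. 6.7] -/
def dicutPreds : Set ((Fin 2 → Bool) → Bool) := {dicutPred}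

/-- The binary conjunction; Max-2-CONJSAT (Def. 6.3) is the CSP of "all possible conjunctions of two literals",
`literalClosure andTwo`. [cite: BraunPokuttaZink2015, Def. 6.3] -/
def andTwo : (Fin 2 → Bool) → Bool := fun y => y 0 && y 1

/-- `¬x_i ∧ x_j` is a conjunction of two literals. [cite: BraunPokuttaZink2015, Def. 6.3 and Def. 6.7] -/
theorem dicutPred_mem_literalClosure : dicutPred ∈ literalClosure andTwo :=
  ⟨fun j => j = 0, by funext y; simp [andTwo, dicutPred]⟩

/-- Swapping the two arguments of a binary constraint. [folklore] -/
private def swapEmb : Fin 2 ↪ Fin 2 := (Equiv.swap (0 : Fin 2) 1).toEmbedding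

/-- **Cor. 6.8 reduction MaxCUT → MaxDICUT** ("replace every clause `l = (x_i ⊕ x_j = 1)` with
`C_1(l) = ¬x_i ∧ x_j` and `C_2(l) = x_i ∧ ¬x_j`"), for any family containing `¬y_0 ∧ y_1` (the second
constraint is the first on the reversed scope). [cite: BraunPokuttaZink2015, Cor. 6.8 and its proof] -/
def dicutInst (hP : dicutPred ∈ P₂) (I : CSPInstance 2 n maxCutPreds) : CSPInstance 2 n P₂ :=
  I.expand 2 two_pos fun C b =>
    if b = 0 then ⟨dicutPred, hP, C.idx⟩ else ⟨dicutPred, hP, swapEmb.trans C.idx⟩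

/-- "Whenever `x_i ⊕ x_j = 1` is satisfied … exactly one of `¬x_i ∧ x_j` and `x_i ∧ ¬x_j` is also satisfied …
If … not fulfilled … then neither": `#sat = [x_i ≠ x_j]`. [cite: BraunPokuttaZink2015, proof of Cor. 6.8] -/
theorem dicutInst_count (hP : dicutPred ∈ P₂) (C : CSPConstraint 2 n maxCutPreds) (x : Fin n → Bool) :
    (∑ b : Fin 2, if (CSPConstraint.sat (P := P₂)
        (if b = 0 then ⟨dicutPred, hP, C.idx⟩ else ⟨dicutPred, hP, swapEmb.trans C.idx⟩) x)
        then (1 : ℝ) else 0) = 1 * (if C.sat x then (1 : ℝ) else 0) + 0 := by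
  rw [Fin.sum_univ_two, maxCut_sat]
  simp only [Fin.isValue, if_true, one_ne_zero, if_false, CSPConstraint.sat, dicutPred, swapEmb,
    Function.Embedding.trans_apply, Equiv.coe_toEmbedding, Equiv.swap_apply_left, Equiv.swap_apply_right]
  rcases Bool.eq_false_or_eq_true (x (C.idx 0)) with ha | ha <;>
    rcases Bool.eq_false_or_eq_true (x (C.idx 1)) with hb | hb <;> simp [ha, hb]

/-- `ℑ(x) = 2·ℑ_DICUT(x)`. [cite: BraunPokuttaZink2015, proof of Cor. 6.8] -/
theorem dicutInst_val (hP : dicutPred ∈ P₂) (I : CSPInstance 2 n maxCutPreds) (x : Fin n → Bool) :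
    I.val x = 2 * (dicutInst hP I).val x + 0 := by
  rw [dicutInst, I.expand_val two_pos _ (dicutInst_count hP) x]
  push_cast
  ring

/-- Soundness: `opt(ℑ) ≤ s ⇒ opt(ℑ_DICUT) ≤ s/2`. [cite: BraunPokuttaZink2015, Def. 4.1 (2) and proof of Cor. 6.8] -/
theorem dicutInst_optLE (hP : dicutPred ∈ P₂) (I : CSPInstance 2 n maxCutPreds) {s : ℝ} (hI : I.OptLE s) :
    (dicutInst hP I).OptLE (s / 2) := by
  have h := I.expand_optLE two_pos _ zero_le_one (dicutInst_count hP) hI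
  have e : ((1 : ℝ) * s + 0) / ((2 : ℕ) : ℝ) = s / 2 := by rw [Nat.cast_ofNat]; ring
  rw [e] at h
  exact h

/-! ### LP relaxations travel back to MaxCUT (Prop. 4.2, LP clause) -/

variable {R : ℕ} {c s : ℝ}

/-- From an LP relaxation of a binary CSP containing `≠` achieving `(c, s)`, one of MaxCUT of size `R + 2`
achieving `(c, s)`. [cite: BraunPokuttaZink2015, Prop. 4.2 and Cor. 6.4] -/
theorem LPRelaxation.maxCut_of_incl (hP : neqPred ∈ P₂) (L : LPRelaxation 2 n P₂ R) (hL : L.Achieves c s) :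
    ∃ L' : LPRelaxation 2 n maxCutPreds (R + 2), L'.Achieves c s :=
  ⟨L.pullback (inclInst hP) id 1 0 (inclInst_val hP),
    hL.pullback zero_le_one (show (1 : ℝ) * c + 0 ≤ c by linarith) fun I hI => inclInst_optLE hP I hI⟩

/-- From an LP relaxation of a binary CSP containing the two clauses achieving `((1+c)/2, (1+s)/2)`, one of
MaxCUT of size `R + 2` achieving `(c, s)`. [cite: BraunPokuttaZink2015, Prop. 4.2 and Cor. 6.6] -/
theorem LPRelaxation.maxCut_of_sat (h0 : clausePred (fun _ => false) ∈ P₂)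
    (h1 : clausePred (fun _ => true) ∈ P₂) (L : LPRelaxation 2 n P₂ R)
    (hL : L.Achieves ((1 + c) / 2) ((1 + s) / 2)) :
    ∃ L' : LPRelaxation 2 n maxCutPreds (R + 2), L'.Achieves c s :=
  ⟨L.pullback (satInst h0 h1) id 2 (-1) (satInst_val h0 h1),
    hL.pullback zero_le_two (show (2 : ℝ) * ((1 + c) / 2) + -1 ≤ c by linarith) fun I hI => satInst_optLE h0 h1 I hI⟩

/-- From an LP relaxation of a binary CSP containing `¬y_0 ∧ y_1` achieving `(c/2, s/2)`, one of MaxCUT of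
size `R + 2` achieving `(c, s)`. [cite: BraunPokuttaZink2015, Prop. 4.2 and Cor. 6.8] -/
theorem LPRelaxation.maxCut_of_dicut (hP : dicutPred ∈ P₂) (L : LPRelaxation 2 n P₂ R)
    (hL : L.Achieves (c / 2) (s / 2)) :
    ∃ L' : LPRelaxation 2 n maxCutPreds (R + 2), L'.Achieves c s :=
  ⟨L.pullback (dicutInst hP) id 2 0 (dicutInst_val hP),
    hL.pullback zero_le_two (show (2 : ℝ) * (c / 2) + 0 ≤ c by linarith) fun I hI => dicutInst_optLE hP I hI⟩

end Reductions

/-! ### Size bookkeeping -/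

/-- `N^C + 2 ≤ N^{C+1}` for `N ≥ 3`. [folklore] -/
private theorem pow_add_two_le {N : ℕ} (hN : 3 ≤ N) (C : ℕ) : (N : ℝ) ^ C + 2 ≤ (N : ℝ) ^ (C + 1) := by
  have hN' : (3 : ℝ) ≤ N := by exact_mod_cast hN
  have h1 : (1 : ℝ) ≤ (N : ℝ) ^ C := one_le_pow₀ (by linarith)
  rw [pow_succ]
  nlinarith

/-- `n^{d/2} + 2 ≤ n^{(d+2)/2}` for `n ≥ 3`. [folklore] -/
private theorem rpow_add_two_le {n : ℕ} (hn : 3 ≤ n) (d : ℕ) :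
    (n : ℝ) ^ ((d : ℝ) / 2) + 2 ≤ (n : ℝ) ^ (((d : ℝ) + 2) / 2) := by
  have hn' : (3 : ℝ) ≤ n := by exact_mod_cast hn
  have h1 : (1 : ℝ) ≤ (n : ℝ) ^ ((d : ℝ) / 2) := Real.one_le_rpow (by linarith) (by positivity)
  have : (n : ℝ) ^ (((d : ℝ) + 2) / 2) = (n : ℝ) ^ ((d : ℝ) / 2) * n := by
    rw [show (((d : ℝ) + 2) / 2) = (d : ℝ) / 2 + 1 by ring, Real.rpow_add (by linarith), Real.rpow_one]
  rw [this]
  nlinarith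

/-- `cutVars n ≥ 3` for `n ≥ 1`. [folklore] -/
private theorem three_le_cutVars {n : ℕ} (hn : 1 ≤ n) : 3 ≤ cutVars n := by
  rw [cutVars_eq]
  have h3 : 1 ≤ n ^ 3 := Nat.one_le_pow _ _ hn
  omega

/-! ### Unconditional consequences (MaxCUT input: the gadget constants `16/17`) -/

section Unconditional

/-- **Max-2-CSP, unconditional:** for every binary predicate family containing `≠` (e.g. all binary predicates,
Def. 6.3), every `ε > 0` and `C`: for all large `n` no LP relaxation of size `≤ N^C` on `N = cutVars n` variables
achieves `((17−2ε)/21, (16+2ε)/21)`. [cite: BraunPokuttaZink2015, Cor. 6.4 (LP clause)] -/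
theorem binaryCsp_poly_lp_of_neq {P₂ : Set ((Fin 2 → Bool) → Bool)} (hP : neqPred ∈ P₂) {ε : ℝ} (hε : 0 < ε)
    (C : ℕ) : ∃ n₀ : ℕ, ∀ n : ℕ, n₀ ≤ n → ∀ R : ℕ, (R : ℝ) ≤ ((cutVars n : ℕ) : ℝ) ^ C →
      ∀ L : LPRelaxation 2 (cutVars n) P₂ R, ¬ L.Achieves ((17 - 2 * ε) / 21) ((16 + 2 * ε) / 21) := by
  obtain ⟨n₀, H⟩ := maxCut_poly_lp hε (C + 1)
  refine ⟨max n₀ 1, fun n hn R hR L hL => ?_⟩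
  obtain ⟨L', hL'⟩ := L.maxCut_of_incl hP hL
  refine H n (le_trans (le_max_left _ _) hn) (R + 2) ?_ L' hL'
  push_cast
  linarith [pow_add_two_le (three_le_cutVars (le_trans (le_max_right _ _) hn)) C]

/-- **Max-2-SAT, unconditional** (ratio `37/38`): for every `ε > 0` and `C`, for all large `n` no LP relaxation
of Max-2-SAT of size `≤ N^C` on `N = cutVars n` variables achieves `((19−ε)/21, (37+2ε)/42)`; stated for any
binary family containing the clauses `y_0 ∨ y_1`, `ȳ_0 ∨ ȳ_1` (`maxKSatPreds 2`: `maxTwoSat_poly_lp`).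
[cite: BraunPokuttaZink2015, Cor. 6.6 (LP clause, reduction) with the MaxCUT input of `maxCut_poly_lp`] -/
theorem binaryCsp_poly_lp_of_clauses {P₂ : Set ((Fin 2 → Bool) → Bool)}
    (h0 : clausePred (fun _ => false) ∈ P₂) (h1 : clausePred (fun _ => true) ∈ P₂) {ε : ℝ} (hε : 0 < ε)
    (C : ℕ) : ∃ n₀ : ℕ, ∀ n : ℕ, n₀ ≤ n → ∀ R : ℕ, (R : ℝ) ≤ ((cutVars n : ℕ) : ℝ) ^ C →
      ∀ L : LPRelaxation 2 (cutVars n) P₂ R, ¬ L.Achieves ((19 - ε) / 21) ((37 + 2 * ε) / 42) := by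
  obtain ⟨n₀, H⟩ := maxCut_poly_lp hε (C + 1)
  refine ⟨max n₀ 1, fun n hn R hR L hL => ?_⟩
  have e1 : (19 - ε) / 21 = (1 + (17 - 2 * ε) / 21) / 2 := by ring
  have e2 : (37 + 2 * ε) / 42 = (1 + (16 + 2 * ε) / 21) / 2 := by ring
  have hL' : L.Achieves ((1 + (17 - 2 * ε) / 21) / 2) ((1 + (16 + 2 * ε) / 21) / 2) := by
    rw [← e1, ← e2]; exact hL
  obtain ⟨L', hL''⟩ := L.maxCut_of_sat h0 h1 hL'
  refine H n (le_trans (le_max_left _ _) hn) (R + 2) ?_ L' hL''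
  push_cast
  linarith [pow_add_two_le (three_le_cutVars (le_trans (le_max_right _ _) hn)) C]

/-- **Max-2-SAT, unconditional.** [cite: BraunPokuttaZink2015, Cor. 6.6 (LP clause, reduction) with the MaxCUT input of `maxCut_poly_lp`] -/
theorem maxTwoSat_poly_lp {ε : ℝ} (hε : 0 < ε) (C : ℕ) :
    ∃ n₀ : ℕ, ∀ n : ℕ, n₀ ≤ n → ∀ R : ℕ, (R : ℝ) ≤ ((cutVars n : ℕ) : ℝ) ^ C →
      ∀ L : LPRelaxation 2 (cutVars n) (maxKSatPreds 2) R, ¬ L.Achieves ((19 - ε) / 21) ((37 + 2 * ε) / 42) :=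
  binaryCsp_poly_lp_of_clauses (clausePred_mem _) (clausePred_mem _) hε C

/-- **MaxDICUT / Max-2-CONJSAT, unconditional** (ratio `16/17`): for any binary family containing `¬y_0 ∧ y_1`,
every `ε > 0` and `C`: for all large `n` no LP relaxation of size `≤ N^C` on `N = cutVars n` variables achieves
`((17−2ε)/42, (8+ε)/21)`. [cite: BraunPokuttaZink2015, Cor. 6.8 and Cor. 6.4 (LP clauses, reductions) with the MaxCUT input of `maxCut_poly_lp`] -/
theorem binaryCsp_poly_lp_of_dicut {P₂ : Set ((Fin 2 → Bool) → Bool)} (hP : dicutPred ∈ P₂) {ε : ℝ}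
    (hε : 0 < ε) (C : ℕ) : ∃ n₀ : ℕ, ∀ n : ℕ, n₀ ≤ n → ∀ R : ℕ, (R : ℝ) ≤ ((cutVars n : ℕ) : ℝ) ^ C →
      ∀ L : LPRelaxation 2 (cutVars n) P₂ R, ¬ L.Achieves ((17 - 2 * ε) / 42) ((8 + ε) / 21) := by
  obtain ⟨n₀, H⟩ := maxCut_poly_lp hε (C + 1)
  refine ⟨max n₀ 1, fun n hn R hR L hL => ?_⟩
  have e1 : (17 - 2 * ε) / 42 = ((17 - 2 * ε) / 21) / 2 := by ring
  have e2 : (8 + ε) / 21 = ((16 + 2 * ε) / 21) / 2 := by ring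
  have hL' : L.Achieves (((17 - 2 * ε) / 21) / 2) (((16 + 2 * ε) / 21) / 2) := by
    rw [← e1, ← e2]; exact hL
  obtain ⟨L', hL''⟩ := L.maxCut_of_dicut hP hL'
  refine H n (le_trans (le_max_left _ _) hn) (R + 2) ?_ L' hL''
  push_cast
  linarith [pow_add_two_le (three_le_cutVars (le_trans (le_max_right _ _) hn)) C]

/-- **MaxDICUT, unconditional.** [cite: BraunPokuttaZink2015, Cor. 6.8 (LP clause, reduction) with the MaxCUT input of `maxCut_poly_lp`] -/
theorem maxDicut_poly_lp {ε : ℝ} (hε : 0 < ε) (C : ℕ) :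
    ∃ n₀ : ℕ, ∀ n : ℕ, n₀ ≤ n → ∀ R : ℕ, (R : ℝ) ≤ ((cutVars n : ℕ) : ℝ) ^ C →
      ∀ L : LPRelaxation 2 (cutVars n) dicutPreds R, ¬ L.Achieves ((17 - 2 * ε) / 42) ((8 + ε) / 21) :=
  binaryCsp_poly_lp_of_dicut (P₂ := dicutPreds) (Set.mem_singleton _) hε C

/-- **Max-2-CONJSAT, unconditional.** [cite: BraunPokuttaZink2015, Cor. 6.4 (Max-2-CONJSAT, LP clause) with the MaxCUT input of `maxCut_poly_lp`] -/
theorem maxTwoConjSat_poly_lp {ε : ℝ} (hε : 0 < ε) (C : ℕ) :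
    ∃ n₀ : ℕ, ∀ n : ℕ, n₀ ≤ n → ∀ R : ℕ, (R : ℝ) ≤ ((cutVars n : ℕ) : ℝ) ^ C →
      ∀ L : LPRelaxation 2 (cutVars n) (literalClosure andTwo) R,
        ¬ L.Achieves ((17 - 2 * ε) / 42) ((8 + ε) / 21) :=
  binaryCsp_poly_lp_of_dicut dicutPred_mem_literalClosure hε C

end Unconditional

/-! ### The printed constants, conditional on [CMM09] (the tree's `CharikarMakarychevMakarychev2009_maxCutSA`) -/

section Conditional

/-- **Cor. 6.4 (Max-2-CSP), LP clause, as printed** (given [CMM09]): `fc(Max-2-CSP, 1−ε, 1/2+ε) ≥ n^{Ω(log n/loglog n)}`,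
here in the polynomial regime of the tree's MaxCUT input: for every binary family containing `≠`, every `ε > 0`
and `d ≥ 2`, for all large `n` no LP relaxation of size `≤ n^{d/2}` achieves `(1−ε, 1/2+ε)`.
[cite: BraunPokuttaZink2015, Cor. 6.4 (LP clause)] -/
theorem binaryCsp_poly_lp_of_neq_of_CMM (hCMM : CharikarMakarychevMakarychev2009_maxCutSA) {P₂ : Set ((Fin 2 → Bool) → Bool)} (hP : neqPred ∈ P₂) {ε : ℝ}
    (hε : 0 < ε) {d : ℕ} (hd : 2 ≤ d) :
    ∃ n₀ : ℕ, ∀ n : ℕ, n₀ ≤ n → ∀ R : ℕ, (R : ℝ) ≤ (n : ℝ) ^ ((d : ℝ) / 2) →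
      ∀ L : LPRelaxation 2 n P₂ R, ¬ L.Achieves (1 - ε) (1 / 2 + ε) := by
  obtain ⟨n₀, H⟩ := maxCut_poly_lp_of_CMM hCMM hε (d := d + 2) (by omega)
  refine ⟨max n₀ 3, fun n hn R hR L hL => ?_⟩
  obtain ⟨L', hL'⟩ := L.maxCut_of_incl hP hL
  refine H n (le_trans (le_max_left _ _) hn) (R + 2) ?_ L' hL'
  push_cast
  linarith [rpow_add_two_le (le_trans (le_max_right _ _) hn) d]

/-- **Cor. 6.6 (Max-2-SAT), LP clause, with the printed constants** (given [CMM09]): "`fc(MaxSAT2, 1 − ε, 3/4 + ε)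
≥ n^{Ω(log n/log log n)}` … inapproximability factor `3/4 + Θ(ε)`", here in the polynomial regime of the tree's
MaxCUT input: for every `ε > 0` and `d ≥ 2`, for all large `n`, no LP relaxation of size `≤ n^{d/2}` of a binary
CSP containing the clauses `y_0 ∨ y_1`, `ȳ_0 ∨ ȳ_1` achieves `(1−ε, 3/4+ε)`.
[cite: BraunPokuttaZink2015, Cor. 6.6 (LP clause)] -/
theorem binaryCsp_poly_lp_of_clauses_of_CMM (hCMM : CharikarMakarychevMakarychev2009_maxCutSA) {P₂ : Set ((Fin 2 → Bool) → Bool)}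
    (h0 : clausePred (fun _ => false) ∈ P₂) (h1 : clausePred (fun _ => true) ∈ P₂) {ε : ℝ} (hε : 0 < ε)
    {d : ℕ} (hd : 2 ≤ d) :
    ∃ n₀ : ℕ, ∀ n : ℕ, n₀ ≤ n → ∀ R : ℕ, (R : ℝ) ≤ (n : ℝ) ^ ((d : ℝ) / 2) →
      ∀ L : LPRelaxation 2 n P₂ R, ¬ L.Achieves (1 - ε) (3 / 4 + ε) := by
  obtain ⟨n₀, H⟩ := maxCut_poly_lp_of_CMM hCMM (ε := 2 * ε) (by positivity) (d := d + 2) (by omega)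
  refine ⟨max n₀ 3, fun n hn R hR L hL => ?_⟩
  have e1 : (1 - ε : ℝ) = (1 + (1 - 2 * ε)) / 2 := by ring
  have e2 : (3 / 4 + ε : ℝ) = (1 + (1 / 2 + 2 * ε)) / 2 := by ring
  have hL' : L.Achieves ((1 + (1 - 2 * ε)) / 2) ((1 + (1 / 2 + 2 * ε)) / 2) := by
    rw [← e1, ← e2]; exact hL
  obtain ⟨L', hL''⟩ := L.maxCut_of_sat h0 h1 hL'
  refine H n (le_trans (le_max_left _ _) hn) (R + 2) ?_ L' hL''
  push_cast
  linarith [rpow_add_two_le (le_trans (le_max_right _ _) hn) d]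

/-- **Max-2-SAT with the printed constants `(1−ε, 3/4+ε)`** (given [CMM09]). [cite: BraunPokuttaZink2015, Cor. 6.6 (LP clause)] -/
theorem maxTwoSat_poly_lp_of_CMM (hCMM : CharikarMakarychevMakarychev2009_maxCutSA) {ε : ℝ} (hε : 0 < ε) {d : ℕ} (hd : 2 ≤ d) :
    ∃ n₀ : ℕ, ∀ n : ℕ, n₀ ≤ n → ∀ R : ℕ, (R : ℝ) ≤ (n : ℝ) ^ ((d : ℝ) / 2) →
      ∀ L : LPRelaxation 2 n (maxKSatPreds 2) R, ¬ L.Achieves (1 - ε) (3 / 4 + ε) :=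
  binaryCsp_poly_lp_of_clauses_of_CMM hCMM (clausePred_mem _) (clausePred_mem _) hε hd

/-- **Cor. 6.8 (MaxDICUT) / Cor. 6.4 (Max-2-CONJSAT), LP clauses, with the printed constants** (given [CMM09]):
"`fc(MaxDICUT, 1/2 − ε, 1/4 + ε) ≥ n^{Ω(log n/loglog n)}` achieving inapproximability factor `1/2 + Θ(ε)`", here
in the polynomial regime: for any binary family containing `¬y_0 ∧ y_1`, every `ε > 0` and `d ≥ 2`, for all large
`n` no LP relaxation of size `≤ n^{d/2}` achieves `(1/2 − ε, 1/4 + ε)`.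
[cite: BraunPokuttaZink2015, Cor. 6.8 and Cor. 6.4 (LP clauses)] -/
theorem binaryCsp_poly_lp_of_dicut_of_CMM (hCMM : CharikarMakarychevMakarychev2009_maxCutSA) {P₂ : Set ((Fin 2 → Bool) → Bool)} (hP : dicutPred ∈ P₂) {ε : ℝ}
    (hε : 0 < ε) {d : ℕ} (hd : 2 ≤ d) :
    ∃ n₀ : ℕ, ∀ n : ℕ, n₀ ≤ n → ∀ R : ℕ, (R : ℝ) ≤ (n : ℝ) ^ ((d : ℝ) / 2) →
      ∀ L : LPRelaxation 2 n P₂ R, ¬ L.Achieves (1 / 2 - ε) (1 / 4 + ε) := by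
  obtain ⟨n₀, H⟩ := maxCut_poly_lp_of_CMM hCMM (ε := 2 * ε) (by positivity) (d := d + 2) (by omega)
  refine ⟨max n₀ 3, fun n hn R hR L hL => ?_⟩
  have e1 : (1 / 2 - ε : ℝ) = (1 - 2 * ε) / 2 := by ring
  have e2 : (1 / 4 + ε : ℝ) = (1 / 2 + 2 * ε) / 2 := by ring
  have hL' : L.Achieves ((1 - 2 * ε) / 2) ((1 / 2 + 2 * ε) / 2) := by
    rw [← e1, ← e2]; exact hL
  obtain ⟨L', hL''⟩ := L.maxCut_of_dicut hP hL'
  refine H n (le_trans (le_max_left _ _) hn) (R + 2) ?_ L' hL''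
  push_cast
  linarith [rpow_add_two_le (le_trans (le_max_right _ _) hn) d]

/-- **MaxDICUT with the printed constants `(1/2−ε, 1/4+ε)`** (given [CMM09]). [cite: BraunPokuttaZink2015, Cor. 6.8 (LP clause)] -/
theorem maxDicut_poly_lp_of_CMM (hCMM : CharikarMakarychevMakarychev2009_maxCutSA) {ε : ℝ} (hε : 0 < ε) {d : ℕ} (hd : 2 ≤ d) :
    ∃ n₀ : ℕ, ∀ n : ℕ, n₀ ≤ n → ∀ R : ℕ, (R : ℝ) ≤ (n : ℝ) ^ ((d : ℝ) / 2) →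
      ∀ L : LPRelaxation 2 n dicutPreds R, ¬ L.Achieves (1 / 2 - ε) (1 / 4 + ε) :=
  binaryCsp_poly_lp_of_dicut_of_CMM hCMM (P₂ := dicutPreds) (Set.mem_singleton _) hε hd

/-- **Max-2-CONJSAT with the printed constants `(1/2−ε, 1/4+ε)`** (given [CMM09]). [cite: BraunPokuttaZink2015, Cor. 6.4 (Max-2-CONJSAT, LP clause)] -/
theorem maxTwoConjSat_poly_lp_of_CMM (hCMM : CharikarMakarychevMakarychev2009_maxCutSA) {ε : ℝ} (hε : 0 < ε) {d : ℕ} (hd : 2 ≤ d) :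
    ∃ n₀ : ℕ, ∀ n : ℕ, n₀ ≤ n → ∀ R : ℕ, (R : ℝ) ≤ (n : ℝ) ^ ((d : ℝ) / 2) →
      ∀ L : LPRelaxation 2 n (literalClosure andTwo) R, ¬ L.Achieves (1 / 2 - ε) (1 / 4 + ε) :=
  binaryCsp_poly_lp_of_dicut_of_CMM hCMM dicutPred_mem_literalClosure hε hd

end Conditional

/-! ### Subspace (SDP) clauses: the same reductions for sum-of-squares certificates over a subspace -/

section Subspace

variable {k k' : ℕ} {P₁ : Set ((Fin k → Bool) → Bool)} {P₂ : Set ((Fin k' → Bool) → Bool)}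

/-- **Subspace certificates travel along same-variable affine reductions** (the SDP clause of Prop. 4.2 in the
Lee–Raghavendra–Steurer subspace language of the tree, `AchievesApprox`): if `ℑ(x) = a·ℑ*(x) + θ` (`a ≥ 0`),
`opt(ℑ) ≤ s₁ ⇒ opt(ℑ*) ≤ s₂` and `c₁ = a c₂ + θ`, then a subspace `U` achieving `(c₂, s₂)` on the target achieves
`(c₁, s₁)` on the source: `c₁ − ℑ = a (c₂ − ℑ*) = Σ (√a g_i)²`.
[cite: BraunPokuttaZink2015, Prop. 4.2 (SDP clause)] [cite: LeeRaghavendraSteurer2015, Def. 1.4 and eq. (2) (p. 5–6)] -/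
theorem AchievesApprox.of_affine {U : Submodule ℝ ((Fin n → Bool) → ℝ)}
    (inst : CSPInstance k n P₁ → CSPInstance k' n P₂) {a θ : ℝ} (ha : 0 ≤ a)
    (hval : ∀ (I : CSPInstance k n P₁) (x : Fin n → Bool), I.val x = a * (inst I).val x + θ)
    {c₁ s₁ c₂ s₂ : ℝ} (hc : c₁ = a * c₂ + θ) (hsound : ∀ I : CSPInstance k n P₁, I.OptLE s₁ → (inst I).OptLE s₂)
    (h : AchievesApprox P₂ (U : Set ((Fin n → Bool) → ℝ)) c₂ s₂) :
    AchievesApprox P₁ (U : Set ((Fin n → Bool) → ℝ)) c₁ s₁ := by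
  intro I hI
  obtain ⟨t, g, hg, hcert⟩ := h (inst I) (hsound I hI)
  refine ⟨t, fun i => Real.sqrt a • g i, fun i => U.smul_mem _ (hg i), fun x => ?_⟩
  rw [hval, hc]
  have : ∑ i : Fin t, (Real.sqrt a • g i) x ^ 2 = a * ∑ i : Fin t, g i x ^ 2 := by
    rw [mul_sum]
    refine sum_congr rfl fun i _ => ?_
    rw [Pi.smul_apply, smul_eq_mul, mul_pow, Real.sq_sqrt ha]
  rw [this, ← hcert x]
  ring

variable {P₂' : Set ((Fin 2 → Bool) → Bool)}

/-- Max-2-CSP ⊇ MaxCUT, subspace clause. [cite: BraunPokuttaZink2015, Cor. 6.4 (SDP clause, reduction)] -/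
theorem AchievesApprox.maxCut_of_incl (hP : neqPred ∈ P₂') {U : Submodule ℝ ((Fin n → Bool) → ℝ)} {c s : ℝ}
    (h : AchievesApprox P₂' (U : Set ((Fin n → Bool) → ℝ)) c s) :
    AchievesApprox maxCutPreds (U : Set ((Fin n → Bool) → ℝ)) c s :=
  AchievesApprox.of_affine (inclInst hP) zero_le_one (inclInst_val hP) (by ring) (fun I hI => inclInst_optLE hP I hI) h

/-- Max-2-SAT from MaxCUT, subspace clause. [cite: BraunPokuttaZink2015, Cor. 6.6 (SDP clause, reduction)] -/
theorem AchievesApprox.maxCut_of_sat (h0 : clausePred (fun _ => false) ∈ P₂')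
    (h1 : clausePred (fun _ => true) ∈ P₂') {U : Submodule ℝ ((Fin n → Bool) → ℝ)} {c s : ℝ}
    (h : AchievesApprox P₂' (U : Set ((Fin n → Bool) → ℝ)) ((1 + c) / 2) ((1 + s) / 2)) :
    AchievesApprox maxCutPreds (U : Set ((Fin n → Bool) → ℝ)) c s :=
  AchievesApprox.of_affine (satInst h0 h1) zero_le_two (satInst_val h0 h1) (by ring)
    (fun I hI => satInst_optLE h0 h1 I hI) h

/-- MaxDICUT from MaxCUT, subspace clause. [cite: BraunPokuttaZink2015, Cor. 6.8 (SDP clause, reduction)] -/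
theorem AchievesApprox.maxCut_of_dicut (hP : dicutPred ∈ P₂') {U : Submodule ℝ ((Fin n → Bool) → ℝ)}
    {c s : ℝ} (h : AchievesApprox P₂' (U : Set ((Fin n → Bool) → ℝ)) (c / 2) (s / 2)) :
    AchievesApprox maxCutPreds (U : Set ((Fin n → Bool) → ℝ)) c s :=
  AchievesApprox.of_affine (dicutInst hP) zero_le_two (dicutInst_val hP) (by ring)
    (fun I hI => dicutInst_optLE hP I hI) h

/-- **Max-2-CSP, small subspaces (LRS Thm. 1.5 shape), unconditional:** for any binary family containing `≠` there is
`γ > 0` such that for `1/2 < s < c < 1` and all large `n`, no subspace `U` of functions on `{0,1}^N`, `N = cutVars n`,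
with `dim U ≤ N^{γ log N/log log N}` achieves a `((15+2c)/21, (15+2s)/21)`-approximation.
[cite: BraunPokuttaZink2015, Cor. 6.4 (SDP clause, reduction) with the MaxCUT input of `maxCut_subspace_quasipoly`] -/
theorem binaryCsp_subspace_quasipoly_of_neq (hP : neqPred ∈ P₂') :
    ∃ γ : ℝ, 0 < γ ∧ ∀ s : ℝ, 1 / 2 < s → ∀ c : ℝ, s < c → c < 1 →
      ∃ n₀ : ℕ, ∀ n : ℕ, n₀ ≤ n → ∀ U : Submodule ℝ ((Fin (cutVars n) → Bool) → ℝ),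
        (Module.finrank ℝ U : ℝ) ≤ ((cutVars n : ℕ) : ℝ) ^
          (γ * Real.log (cutVars n) / Real.log (Real.log (cutVars n))) →
        ¬ AchievesApprox P₂' (U : Set ((Fin (cutVars n) → Bool) → ℝ)) ((15 + 2 * c) / 21) ((15 + 2 * s) / 21) := by
  obtain ⟨γ, hγ, H⟩ := maxCut_subspace_quasipoly
  refine ⟨γ, hγ, fun s hs c hsc hc1 => ?_⟩
  obtain ⟨n₀, Hn⟩ := H s hs c hsc hc1
  exact ⟨n₀, fun n hn U hU hA => Hn n hn U hU (hA.maxCut_of_incl hP)⟩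

/-- **Max-2-SAT, small subspaces, unconditional** (ratio `→ 37/38`): `γ > 0` such that for `1/2 < s < c < 1` and all
large `n`, no subspace of dimension `≤ N^{γ log N/loglog N}` (`N = cutVars n`) achieves `((18+c)/21, (18+s)/21)` for any
binary family containing the clauses `y_0 ∨ y_1`, `ȳ_0 ∨ ȳ_1`.
[cite: BraunPokuttaZink2015, Cor. 6.6 (SDP clause, reduction) with the MaxCUT input of `maxCut_subspace_quasipoly`] -/
theorem binaryCsp_subspace_quasipoly_of_clauses (h0 : clausePred (fun _ => false) ∈ P₂')
    (h1 : clausePred (fun _ => true) ∈ P₂') :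
    ∃ γ : ℝ, 0 < γ ∧ ∀ s : ℝ, 1 / 2 < s → ∀ c : ℝ, s < c → c < 1 →
      ∃ n₀ : ℕ, ∀ n : ℕ, n₀ ≤ n → ∀ U : Submodule ℝ ((Fin (cutVars n) → Bool) → ℝ),
        (Module.finrank ℝ U : ℝ) ≤ ((cutVars n : ℕ) : ℝ) ^
          (γ * Real.log (cutVars n) / Real.log (Real.log (cutVars n))) →
        ¬ AchievesApprox P₂' (U : Set ((Fin (cutVars n) → Bool) → ℝ)) ((18 + c) / 21) ((18 + s) / 21) := by
  obtain ⟨γ, hγ, H⟩ := maxCut_subspace_quasipoly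
  refine ⟨γ, hγ, fun s hs c hsc hc1 => ?_⟩
  obtain ⟨n₀, Hn⟩ := H s hs c hsc hc1
  refine ⟨n₀, fun n hn U hU hA => Hn n hn U hU (AchievesApprox.maxCut_of_sat h0 h1 ?_)⟩
  have e1 : (1 + (15 + 2 * c) / 21) / 2 = (18 + c) / 21 := by ring
  have e2 : (1 + (15 + 2 * s) / 21) / 2 = (18 + s) / 21 := by ring
  rw [e1, e2]; exact hA

/-- **Max-2-SAT, small subspaces, unconditional.** [cite: BraunPokuttaZink2015, Cor. 6.6 (SDP clause, reduction) with the MaxCUT input of `maxCut_subspace_quasipoly`] -/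
theorem maxTwoSat_subspace_quasipoly :
    ∃ γ : ℝ, 0 < γ ∧ ∀ s : ℝ, 1 / 2 < s → ∀ c : ℝ, s < c → c < 1 →
      ∃ n₀ : ℕ, ∀ n : ℕ, n₀ ≤ n → ∀ U : Submodule ℝ ((Fin (cutVars n) → Bool) → ℝ),
        (Module.finrank ℝ U : ℝ) ≤ ((cutVars n : ℕ) : ℝ) ^
          (γ * Real.log (cutVars n) / Real.log (Real.log (cutVars n))) →
        ¬ AchievesApprox (maxKSatPreds 2) (U : Set ((Fin (cutVars n) → Bool) → ℝ)) ((18 + c) / 21) ((18 + s) / 21) :=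
  binaryCsp_subspace_quasipoly_of_clauses (clausePred_mem _) (clausePred_mem _)

/-- **MaxDICUT / Max-2-CONJSAT, small subspaces, unconditional** (ratio `→ 16/17`): for any binary family containing
`¬y_0 ∧ y_1`, no subspace of dimension `≤ N^{γ log N/loglog N}` achieves `((15+2c)/42, (15+2s)/42)` (`1/2 < s < c < 1`,
large `n`, `N = cutVars n`).
[cite: BraunPokuttaZink2015, Cor. 6.8 and Cor. 6.4 (SDP clauses, reductions) with the MaxCUT input of `maxCut_subspace_quasipoly`] -/
theorem binaryCsp_subspace_quasipoly_of_dicut (hP : dicutPred ∈ P₂') :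
    ∃ γ : ℝ, 0 < γ ∧ ∀ s : ℝ, 1 / 2 < s → ∀ c : ℝ, s < c → c < 1 →
      ∃ n₀ : ℕ, ∀ n : ℕ, n₀ ≤ n → ∀ U : Submodule ℝ ((Fin (cutVars n) → Bool) → ℝ),
        (Module.finrank ℝ U : ℝ) ≤ ((cutVars n : ℕ) : ℝ) ^
          (γ * Real.log (cutVars n) / Real.log (Real.log (cutVars n))) →
        ¬ AchievesApprox P₂' (U : Set ((Fin (cutVars n) → Bool) → ℝ)) ((15 + 2 * c) / 42) ((15 + 2 * s) / 42) := by
  obtain ⟨γ, hγ, H⟩ := maxCut_subspace_quasipoly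
  refine ⟨γ, hγ, fun s hs c hsc hc1 => ?_⟩
  obtain ⟨n₀, Hn⟩ := H s hs c hsc hc1
  refine ⟨n₀, fun n hn U hU hA => Hn n hn U hU (AchievesApprox.maxCut_of_dicut hP ?_)⟩
  have e1 : (15 + 2 * c) / 21 / 2 = (15 + 2 * c) / 42 := by ring
  have e2 : (15 + 2 * s) / 21 / 2 = (15 + 2 * s) / 42 := by ring
  rw [e1, e2]; exact hA

/-- **MaxDICUT, small subspaces, unconditional.** [cite: BraunPokuttaZink2015, Cor. 6.8 (SDP clause, reduction) with the MaxCUT input of `maxCut_subspace_quasipoly`] -/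
theorem maxDicut_subspace_quasipoly :
    ∃ γ : ℝ, 0 < γ ∧ ∀ s : ℝ, 1 / 2 < s → ∀ c : ℝ, s < c → c < 1 →
      ∃ n₀ : ℕ, ∀ n : ℕ, n₀ ≤ n → ∀ U : Submodule ℝ ((Fin (cutVars n) → Bool) → ℝ),
        (Module.finrank ℝ U : ℝ) ≤ ((cutVars n : ℕ) : ℝ) ^
          (γ * Real.log (cutVars n) / Real.log (Real.log (cutVars n))) →
        ¬ AchievesApprox dicutPreds (U : Set ((Fin (cutVars n) → Bool) → ℝ)) ((15 + 2 * c) / 42) ((15 + 2 * s) / 42) :=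
  binaryCsp_subspace_quasipoly_of_dicut (P₂' := dicutPreds) (Set.mem_singleton _)

/-- **Max-2-CONJSAT, small subspaces, unconditional.** [cite: BraunPokuttaZink2015, Cor. 6.4 (Max-2-CONJSAT, SDP clause, reduction) with the MaxCUT input of `maxCut_subspace_quasipoly`] -/
theorem maxTwoConjSat_subspace_quasipoly :
    ∃ γ : ℝ, 0 < γ ∧ ∀ s : ℝ, 1 / 2 < s → ∀ c : ℝ, s < c → c < 1 →
      ∃ n₀ : ℕ, ∀ n : ℕ, n₀ ≤ n → ∀ U : Submodule ℝ ((Fin (cutVars n) → Bool) → ℝ),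
        (Module.finrank ℝ U : ℝ) ≤ ((cutVars n : ℕ) : ℝ) ^
          (γ * Real.log (cutVars n) / Real.log (Real.log (cutVars n))) →
        ¬ AchievesApprox (literalClosure andTwo) (U : Set ((Fin (cutVars n) → Bool) → ℝ))
          ((15 + 2 * c) / 42) ((15 + 2 * s) / 42) :=
  binaryCsp_subspace_quasipoly_of_dicut dicutPred_mem_literalClosure

end Subspace

end Literature.Combinatorics.Optimization

end
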